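import Summits.ResolutionOfSingularities.ResolutionOfSingularities.Theorems.HomologicalConductorNoZenoHighDimSandwich
import Summits.ResolutionOfSingularities.ResolutionOfSingularities.Theorems.HomologicalConductorStrictDropTowerShape
import HarnessLib

/-!
# Crux `NoZenoR` (stmt-ResolutionOfSingularities-19943), slots 2/3 (exhaustive branches): INTERLACING —
# in transcendence degree `≤ 3` an `O`-exhausting `ca`-tower is interlaced with regular local rings dominated by `O`

OURS (cell res-hironaka, crux chain W4.4; lead res-L0-w44-lead-1 g9, DESK WORD 39 OBJECT 2-R′).  AI-written, weaker than expert review;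
nothing here is a statement of the manuscript under review (Hironaka 2017).  SUPPORT-level, counted 0.  Def-free.  CONDITIONAL on the
Literature named fact `CossartPiltant2019LU3` (Cossart–Piltant 2019, local uniformization of threefolds, relative form), taken as a binder.

`exists_regular_between_stages_of_LU3`: if the stages `T_m = tower O A m` of the canonical normalised `ca`-tower of an affine model `A`
of `K/k`, `tr.deg_k K ≤ 3`, along a valuation ring `O ∋ k` EXHAUST `O`, then for every `m` there is a REGULAR local `k`-subalgebra
`R ⊆ O` with `Frac R = K`, `loc O R = R` (so `R` is dominated by `O`) and `T_m ≤ R ≤ T_M` for all late `M`.  The tree's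
`NoZeno.Birth.exists_regular_le_tower_of_cossartPiltant2019LU3` gives only `R ≤ T_M`; the lower bound `T_m ≤ R` comes from applying the
RELATIVE local uniformization `LocalUniformization3` to a finitely generated model `X ⊇ A ∪ B` of the stage (`T_m = loc O B`, `B`
finitely generated: `StrictDrop.Birth.TowerShape.stub_towerShape`), so that the uniformizing algebra `A' ⊇ X` satisfies
`T_m = loc O B ≤ loc O A' =: R`; the upper bound is cofinality of the exhausting tower (`exh_le_tower_of_fg`).
`terminates_or_strictlyInterlaced`: hence such a tower either has a regular stage or CROSSES REGULARITY infinitely often —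
`T_m < R < T_M` with `R` regular, for every `m`.

References: V. Cossart, O. Piltant, *Resolution of singularities of arithmetical threefolds*, J. Algebra 529 (2019), §4.1 (LU);
O. Zariski, P. Samuel, *Commutative Algebra* II, VI §5.
-/

noncomputable section

-- single-problem summit: the doubled namespace component `ResolutionOfSingularities` is forced
set_option linter.dupNamespace false

namespace Summit.ResolutionOfSingularities.ResolutionOfSingularities.Theorems.NoZeno.Interlacing

open Summit.ResolutionOfSingularities.ResolutionOfSingularities.Theses.HomologicalConductor
open Summit.ResolutionOfSingularities.ResolutionOfSingularities.Theorems.NoZeno.Birth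
open Summit.ResolutionOfSingularities.ResolutionOfSingularities.Theorems
open Literature.AlgebraicGeometry.Resolution IsLocalRing

variable {k K : Type} [Field k] [Field K] [Algebra k K]

/-- **INTERLACING (modulo `CossartPiltant2019LU3`).**  In transcendence degree `≤ 3`, if the `ca`-tower along `O` exhausts `O`, then for
every stage `T_m` there is a regular local `k`-subalgebra `R ⊆ O` with `Frac R = K`, `loc O R = R`, `T_m ≤ R`, and `R ≤ T_M` for all late
`M`. [cite: CossartPiltant2019, Thm. 1.1 with §4.1 (LU)] -/
theorem exists_regular_between_stages_of_LU3 (hLU3 : CossartPiltant2019LU3.{0}) (p : ℕ) (hp : p.Prime)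
    (k K : Type) [Field k] [CharP k p] [Field K] [Algebra k K] (O : ValuationSubring K) (A : Subalgebra k K)
    (hk : ∀ c : k, algebraMap k K c ∈ O) (hA : A.FG) (hfr : IsFractionRing ↥A K) (hAO : A.toSubring ≤ O.toSubring)
    (htr : Algebra.trdeg k K ≤ 3) (hexh : ∀ x : K, x ∈ O → ∃ m : ℕ, x ∈ tower O A m) (m : ℕ) :
    ∃ R : Subalgebra k K, IsRegularLocalRing ↥R ∧ IsFractionRing ↥R K ∧ R.toSubring ≤ O.toSubring ∧ loc O R = R ∧
      tower O A m ≤ R ∧ ∃ M₀ : ℕ, ∀ M : ℕ, M₀ ≤ M → R ≤ tower O A M := by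
  classical
  haveI := hfr
  -- a finitely generated presentation `T_m = loc O B` of the stage
  have hshape : (∃ B : Subalgebra k K, B.FG ∧ B ≤ tower O A m ∧
      loc O B = tower O A m ∧ ∀ x ∈ tower O A m, ∃ b ∈ B, ∃ s ∈ B, s⁻¹ ∈ O ∧ x = b * s⁻¹) ∧
      IsNoetherianRing ↥(tower O A m) ∧ (tower O A m).toSubring ≤ O.toSubring ∧
      ∀ s ∈ tower O A m, s⁻¹ ∈ O → s⁻¹ ∈ tower O A m :=
    StrictDrop.Birth.TowerShape.stub_towerShape p hp k K O A hk hA hfr hAO m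
  obtain ⟨⟨B, hBfg, hBT, hlocB, -⟩, -, hTO, -⟩ := hshape
  obtain ⟨SB, hSB⟩ := hBfg
  obtain ⟨SA, hSA⟩ := id hA
  -- the finitely generated model `X = k[SA ∪ SB] ⊇ A ∪ B` of the stage
  set X : Subalgebra k K := Algebra.adjoin k ((SA ∪ SB : Finset K) : Set K) with hX
  have hXfg : X.FG := ⟨SA ∪ SB, rfl⟩
  have hAX : A ≤ X := by
    rw [← hSA]
    exact Algebra.adjoin_mono fun y hy => by
      simp only [Finset.coe_union, Set.mem_union, Finset.mem_coe] at hy ⊢; exact Or.inl hy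
  have hBX : B ≤ X := by
    rw [← hSB]
    exact Algebra.adjoin_mono fun y hy => by
      simp only [Finset.coe_union, Set.mem_union, Finset.mem_coe] at hy ⊢; exact Or.inr hy
  have hXO : X.toSubring ≤ O.toSubring := by
    let OA : Subalgebra k K := { O.toSubring with algebraMap_mem' := fun c => hk c }
    have hle : X ≤ OA := by
      refine Algebra.adjoin_le fun y hy => ?_
      simp only [Finset.coe_union, Set.mem_union, Finset.mem_coe] at hy
      rcases hy with hy | hy
      · exact hAO (hSA ▸ Algebra.subset_adjoin hy : y ∈ A)
      · exact hTO (hBT (hSB ▸ Algebra.subset_adjoin hy : y ∈ B))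
    exact fun x hx => hle hx
  haveI hXfr : IsFractionRing ↥X K := isFractionRing_subalgebra_of_le A X hAX
  have hdim : ringKrullDim ↥X ≤ 3 := ringKrullDim_le_of_fg_of_trdeg_le X hXfg (by exact_mod_cast htr)
  -- relative local uniformization of `O` on `X` (Cossart–Piltant)
  obtain ⟨A', hA'O, hXA', hA'fg, hreg⟩ := hLU3 k K O X hXO hXfg hXfr hdim
  haveI : IsFractionRing ↥A' K := isFractionRing_subalgebra_of_le X A' hXA'
  refine ⟨loc O A', ?_, ?_, ?_, ?_, ?_, ?_⟩
  · rw [loc_eq_locAt]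
    exact (SyzygyFlattening.isRegularLocalRing_locAt_iff_atPrime O A' hA'O).mpr hreg
  · rw [loc_eq_locAt]
    exact isFractionRing_subalgebra_of_le A' _ (SyzygyFlattening.self_le_locAt O A')
  · rw [loc_eq_locAt]
    exact SyzygyFlattening.locAt_toSubring_le O hk hA'O
  · rw [loc_eq_locAt]
    exact SyzygyFlattening.locAt_locAt O A' hA'O
  · rw [← hlocB, loc_eq_locAt, loc_eq_locAt]
    exact SyzygyFlattening.locAt_mono O (hBX.trans hXA')
  · obtain ⟨M₀, hM₀⟩ := exh_le_tower_of_fg O A hk hAO hexh A' hA'fg hA'O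
    exact ⟨M₀, fun M hM => (hM₀ M hM).2⟩

/-- **TERMINATES OR STRICTLY INTERLACED (modulo `CossartPiltant2019LU3`).**  In transcendence degree `≤ 3`, an `O`-exhausting
`ca`-tower either has a regular stage, or for every `m` some regular local `R ⊆ O` (`loc O R = R`) sits STRICTLY between two stages:
`T_m < R < T_M` — a non-terminating exhausting tower crosses regularity infinitely often. [cite: CossartPiltant2019, Thm. 1.1 with §4.1 (LU)] -/
theorem terminates_or_strictlyInterlaced (hLU3 : CossartPiltant2019LU3.{0}) (p : ℕ) (hp : p.Prime)
    (k K : Type) [Field k] [CharP k p] [Field K] [Algebra k K] (O : ValuationSubring K) (A : Subalgebra k K)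
    (hk : ∀ c : k, algebraMap k K c ∈ O) (hA : A.FG) (hfr : IsFractionRing ↥A K) (hAO : A.toSubring ≤ O.toSubring)
    (htr : Algebra.trdeg k K ≤ 3) (hexh : ∀ x : K, x ∈ O → ∃ m : ℕ, x ∈ tower O A m) :
    (∃ m : ℕ, IsRegularLocalRing ↥(tower O A m)) ∨
      ∀ m : ℕ, ∃ R : Subalgebra k K, IsRegularLocalRing ↥R ∧ R.toSubring ≤ O.toSubring ∧ loc O R = R ∧
        ∃ M : ℕ, m < M ∧ tower O A m < R ∧ R < tower O A M := by
  classical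
  by_cases hterm : ∃ m : ℕ, IsRegularLocalRing ↥(tower O A m)
  · exact Or.inl hterm
  push Not at hterm
  refine Or.inr fun m => ?_
  obtain ⟨R, hreg, -, hRO, hloc, hTR, M₀, hM₀⟩ :=
    exists_regular_between_stages_of_LU3 hLU3 p hp k K O A hk hA hfr hAO htr hexh m
  refine ⟨R, hreg, hRO, hloc, max M₀ (m + 1), by omega, lt_of_le_of_ne hTR ?_, lt_of_le_of_ne (hM₀ _ (le_max_left _ _)) ?_⟩
  · intro h
    exact hterm m (h ▸ hreg)
  · intro h
    exact hterm (max M₀ (m + 1)) (h ▸ hreg)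

end Summit.ResolutionOfSingularities.ResolutionOfSingularities.Theorems.NoZeno.Interlacing

end
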